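import Literature.Algebra.Homology.ContCohomologyInflation
import HarnessLib

/-!
# The class in `H¹` of a continuous crossed homomorphism (Mathlib `continuousCohomology`)

Companion of `ContCohomologyInflation.lean` (same generic setting: a topological group `G`, a
topological ring `k`, a topological `k[G]`-module `X : TopRep k G`, Mathlib's homogeneous continuous
cochains).  There it is shown that the homogeneous `1`-cocycles ARE the continuous crossed
homomorphisms (`twoOf`, `twoOf_mem_invariants`, `d_twoOf`, `cocycle_eq`).  Here the crossed
homomorphism is turned into an honest ELEMENT of Mathlib's abstract objects:

* `cocycleMk F hF : cocycles X 1` — the point of the (abstract) cycles object `Z¹(G, X)` defined by a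
  homogeneous `1`-cochain `F` with `d F = 0` (through `liftCycles` applied to Mathlib's CONCRETE
  kernel `TopModuleCat.ker d¹`); `iCycles_cocycleMk`: its image in the cochains is `F`;
  `cocycles_ext`: points of `Z¹` are determined by their cochains;
* `crossedHomCocycle f hf`, `crossedHomClass f hf : H¹(G, X)` — the cocycle and the COHOMOLOGY CLASS
  of a continuous crossed homomorphism `f : G → X`, `f (x y) = f x + x • f y`
  ("`H¹(G, A)` est le groupe des classes d'homomorphismes croisés continus",
  [cite: SerreGaloisCohomology1997, I §2.3]);
* `map_crossedHomClass`: functoriality — along `φ : H → G` and `u : X|_H → Y` the class of `f` maps to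
  the class of `u ∘ f ∘ φ` (restriction / inflation of Kummer-type classes,
  [cite: SerreGaloisCohomology1997, I §2.4]).

Written for abc-iut-L4-t1's "`P_U ⊆ H¹(Π_U, M_X)`" ([AbsTopIII] Prop. 1.6 (iii) / 1.8: Kummer classes
of functions as crossed homomorphisms into the REAL cyclotome `cyclotomeModH1`); generic, no
anabelian content.
-/

noncomputable section

open CategoryTheory TopRep ContRepresentation Topology

namespace ContinuousCohomology

universe u v w

variable {k : Type u} [Ring k] [TopologicalSpace k]
variable {G H : Type v} [Group G] [TopologicalSpace G] [IsTopologicalGroup G]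
  [Group H] [TopologicalSpace H] [IsTopologicalGroup H]

/-! ### Elements of the abstract cycles object from concrete cocycles -/

section Cycles

variable (X : TopRep.{max v w} k G)

/-- The comparison from the CONCRETE kernel of `d¹` (Mathlib `TopModuleCat.ker`, the kernel
submodule with the subspace topology) to the abstract cycles object `Z¹(G, X)` of the homogeneous
cochain complex. [cite: SerreGaloisCohomology1997, I §2.3] -/
def kerToCycles :
    TopModuleCat.ker ((homogeneousCochains X).d 1 2) ⟶ (homogeneousCochains X).cycles 1 :=
  (homogeneousCochains X).liftCycles (TopModuleCat.kerι _) 2 (CochainComplex.next ℕ 1)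
    (TopModuleCat.kerι_comp _)

/-- The point of Mathlib's abstract cycles object `Z¹(G, X)` defined by a homogeneous `1`-cochain
`F` with `d F = 0`. [cite: SerreGaloisCohomology1997, I §2.3] -/
def cocycleMk (F : (homogeneousCochains X).X 1) (hF : ((homogeneousCochains X).d 1 2).hom F = 0) :
    (homogeneousCochains X).cycles 1 :=
  (kerToCycles X).hom ⟨F, hF⟩

/-- The underlying cochain of `cocycleMk F hF` is `F`. [cite: SerreGaloisCohomology1997, I §2.3] -/
@[simp] theorem iCycles_cocycleMk (F : (homogeneousCochains X).X 1)
    (hF : ((homogeneousCochains X).d 1 2).hom F = 0) :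
    ((homogeneousCochains X).iCycles 1).hom (cocycleMk X F hF) = F := by
  have h := (homogeneousCochains X).liftCycles_i (TopModuleCat.kerι _) 2 (CochainComplex.next ℕ 1)
    (TopModuleCat.kerι_comp ((homogeneousCochains X).d 1 2))
  exact congrArg (fun f => f.hom ⟨F, hF⟩) h

/-- `iCycles` is injective on points (a monomorphism of topological modules; the forgetful functor
to modules preserves monomorphisms). [cite: SerreGaloisCohomology1997, I §2.3] -/
theorem cocycles_ext {z z' : (homogeneousCochains X).cycles 1}
    (h : ((homogeneousCochains X).iCycles 1).hom z = ((homogeneousCochains X).iCycles 1).hom z') :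
    z = z' := by
  have hm : Mono ((forget₂ (TopModuleCat k) (ModuleCat k)).map ((homogeneousCochains X).iCycles 1)) :=
    inferInstance
  exact (ModuleCat.mono_iff_injective _).mp hm h

end Cycles

/-! ### The class of a continuous crossed homomorphism -/

section CrossedHom

variable (X : TopRep.{max v w} k G)

/-- The homogeneous `1`-cocycle `(x, y) ↦ f y − f x` of a continuous crossed homomorphism `f`, as a
point of `Z¹(G, X)`. [cite: SerreGaloisCohomology1997, I §2.3] -/
def crossedHomCocycle (f : C(G, X)) (hf : ∀ x y, f (x * y) = f x + X.ρ x (f y)) :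
    (homogeneousCochains X).cycles 1 :=
  cocycleMk X ⟨twoOf X f, twoOf_mem_invariants hf⟩ (by
    apply Subtype.ext
    exact (homogeneousCochains.d_apply X 1 ⟨twoOf X f, twoOf_mem_invariants hf⟩).trans (d_twoOf f))

/-- The underlying cochain of `crossedHomCocycle f hf` is `twoOf X f`.
[cite: SerreGaloisCohomology1997, I §2.3] -/
@[simp] theorem iCycles_crossedHomCocycle (f : C(G, X)) (hf : ∀ x y, f (x * y) = f x + X.ρ x (f y)) :
    (((homogeneousCochains X).iCycles 1).hom (crossedHomCocycle X f hf)).1 = twoOf X f := by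
  rw [crossedHomCocycle, iCycles_cocycleMk]

/-- **The cohomology class `[f] ∈ H¹(G, X)` of a continuous crossed homomorphism `f`.**
[cite: SerreGaloisCohomology1997, I §2.3] -/
def crossedHomClass (f : C(G, X)) (hf : ∀ x y, f (x * y) = f x + X.ρ x (f y)) :
    continuousCohomology 1 X :=
  ((homogeneousCochains X).homologyπ 1).hom (crossedHomCocycle X f hf)

/-- A `0`-cochain: the orbit map `g ↦ g • v` of a vector with continuous orbit map is an invariant
element of `C(G, X)`. [cite: SerreGaloisCohomology1997, I §2.3] -/
def orbitCochain (v : X) (hv : Continuous fun g : G => X.ρ g v) : (homogeneousCochains X).X 0 :=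
  ⟨⟨fun g => X.ρ g v, hv⟩, by
    intro g
    ext x
    change X.ρ g (X.ρ (g⁻¹ * x) v) = X.ρ x v
    rw [← ContinuousLinearMap.comp_apply, ← ContinuousLinearMap.mul_def, ← map_mul,
      mul_inv_cancel_left]⟩

/-- **Principal crossed homomorphisms have class zero**: `[g ↦ g • v − v] = 0` in `H¹(G, X)`
(for `v` with continuous orbit map). [cite: SerreGaloisCohomology1997, I §2.3] -/
theorem crossedHomClass_principal (v : X) (hv : Continuous fun g : G => X.ρ g v)
    (hf : ∀ x y, (⟨fun g => X.ρ g v - v, hv.sub continuous_const⟩ : C(G, X)) (x * y) =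
      (⟨fun g => X.ρ g v - v, hv.sub continuous_const⟩ : C(G, X)) x +
        X.ρ x ((⟨fun g => X.ρ g v - v, hv.sub continuous_const⟩ : C(G, X)) y)) :
    crossedHomClass X ⟨fun g => X.ρ g v - v, hv.sub continuous_const⟩ hf = 0 := by
  -- the cocycle is `d⁰` of the orbit cochain, hence dies under `homologyπ`
  have hcyc : crossedHomCocycle X ⟨fun g => X.ρ g v - v, hv.sub continuous_const⟩ hf =
      ((homogeneousCochains X).toCycles 0 1).hom (orbitCochain X v hv) := by
    apply cocycles_ext
    rw [crossedHomCocycle, iCycles_cocycleMk]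
    have h2 := congrArg (fun f => f.hom (orbitCochain X v hv))
      ((homogeneousCochains X).toCycles_i 0 1)
    simp only [TopModuleCat.hom_comp, ContinuousLinearMap.coe_comp, Function.comp_apply] at h2
    rw [h2]
    apply Subtype.ext
    refine Eq.trans ?_ (homogeneousCochains.d_apply X 0 (orbitCochain X v hv)).symm
    ext x y
    change (X.ρ y v - v) - (X.ρ x v - v) = X.ρ y v - X.ρ x v
    abel
  rw [crossedHomClass, hcyc]
  have h0 := congrArg (fun f => f.hom (orbitCochain X v hv))
    ((homogeneousCochains X).toCycles_comp_homologyπ 0 1)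
  simp only [TopModuleCat.hom_comp, ContinuousLinearMap.coe_comp, Function.comp_apply,
    TopModuleCat.hom_zero, zero_apply] at h0
  exact h0

/-! ### Functoriality of the class -/

variable {X} in
/-- General coefficient form of the inflation/restriction formula on `1`-cochains:
`((cochainsMap φ u) σ)(x)(y) = u (σ (φ x) (φ y))`. [cite: SerreGaloisCohomology1997, I §2.4] -/
theorem cochainsMap_f_one_apply' (φ : H →ₜ* G) {Y : TopRep.{max v w} k H}
    (u : res (φ : H →* G) X ⟶ Y) (σ : (homogeneousCochains X).X 1) (x y : H) :
    (((cochainsMap φ u).f 1).hom σ).1 x y = u.hom (σ.1 (φ x) (φ y)) := rfl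

variable {X} in
omit [IsTopologicalGroup G] [IsTopologicalGroup H] in
/-- Pulling back a continuous crossed homomorphism along `φ : H → G` and pushing along an
`H`-equivariant `u : X|_H → Y` gives a continuous crossed homomorphism `u ∘ f ∘ φ : H → Y`.
[cite: SerreGaloisCohomology1997, I §2.4] -/
theorem crossedHom_comp (φ : H →ₜ* G) {Y : TopRep.{max v w} k H} (u : res (φ : H →* G) X ⟶ Y)
    (f : C(G, X)) (hf : ∀ x y, f (x * y) = f x + X.ρ x (f y)) (a b : H) :
    ((u.hom : X → Y) ∘ f ∘ φ) (a * b) =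
      ((u.hom : X → Y) ∘ f ∘ φ) a + Y.ρ a (((u.hom : X → Y) ∘ f ∘ φ) b) := by
  simp only [Function.comp_apply, map_mul, hf, map_add]
  rw [← TopRep.hom_comm_apply u a (f (φ b))]
  rfl

variable {X} in
/-- **Functoriality of the class of a crossed homomorphism**: along `φ : H → G` and
`u : X|_H → Y`, the induced map `H¹(G, X) → H¹(H, Y)` sends `[f]` to `[u ∘ f ∘ φ]` (restriction to a
subgroup, inflation, change of coefficients). [cite: SerreGaloisCohomology1997, I §2.4] -/
theorem map_crossedHomClass (φ : H →ₜ* G) {Y : TopRep.{max v w} k H} (u : res (φ : H →* G) X ⟶ Y)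
    (f : C(G, X)) (hf : ∀ x y, f (x * y) = f x + X.ρ x (f y)) :
    (map φ u 1).hom (crossedHomClass X f hf) =
      crossedHomClass Y ⟨(u.hom : X → Y) ∘ f ∘ φ,
          u.hom.continuous.comp (f.continuous.comp φ.continuous)⟩ (crossedHom_comp φ u f hf) := by
  have hnat := congrArg (fun g => g.hom (crossedHomCocycle X f hf))
    (HomologicalComplex.homologyπ_naturality (cochainsMap φ u) 1)
  simp only [TopModuleCat.hom_comp, ContinuousLinearMap.coe_comp, Function.comp_apply] at hnat
  change (HomologicalComplex.homologyMap (cochainsMap φ u) 1).hom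
      (((homogeneousCochains X).homologyπ 1).hom (crossedHomCocycle X f hf)) = _
  rw [hnat]
  change _ = ((homogeneousCochains Y).homologyπ 1).hom _
  congr 1
  apply cocycles_ext
  have hi := congrArg (fun g => g.hom (crossedHomCocycle X f hf))
    (HomologicalComplex.cyclesMap_i (cochainsMap φ u) 1)
  simp only [TopModuleCat.hom_comp, ContinuousLinearMap.coe_comp, Function.comp_apply] at hi
  rw [hi, crossedHomCocycle, crossedHomCocycle, iCycles_cocycleMk, iCycles_cocycleMk]
  apply Subtype.ext
  ext x y
  rw [cochainsMap_f_one_apply']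
  change u.hom (twoOf X f (φ x) (φ y)) = twoOf Y _ x y
  rw [twoOf_apply, twoOf_apply, map_sub]
  rfl

end CrossedHom

end ContinuousCohomology
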